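/-
Copyright (c) 2026 The decomp-a2c cell. All rights reserved.
Released under Apache 2.0 license as described in the file LICENSE.
-/
import Summits.AtomisticToContinuum.Crystallization.Theorems.ChartedZeroExcessLayeredLatticeLiouvilleWW

/-!
# ChartedZeroExcessLayeredLatticeLiouville — part WX «AnchorStep»: the bootstrap discharged at a general anchor of the central column
  (decomp-a2c-lens-2, g58; helper of stmt-AtomisticToContinuum-26636, leaf (PC) `ProfileComparisonAt`; memo NODE-g58d §3)

`anchored_increment_le` packages parts WU (comparison data), WV (cubic-threshold bootstrap) and WW (re-anchoring) into ONE estimate with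
NO analytic hypothesis left: for a `ϱ`-harmonic `φ` on `idxBall x₀ n`, a base profile `cf` with `columnFlux (slopeAt φ x₀) cf ≡ colFlux T φ x₀.1 x₀.2`
and bounded increments `‖Δcf‖ ≤ Bc`, an energy scale `ε₁ ≥ √(E/(n²N))`, an anchor offset `s` (`|s| + 3⌊ϱ/c⌋₊ ≤ n/2`) and integer parameters `A, L'`
subject to the four `ϱ`-free / a-priori thresholds of part WV (with `B₀ ≥ √E + Bc + reanchorConst·(n/2)·ε₁`), every layer `β` with
`|β − (x₀.2 + s)| + A ≤ 3L'` satisfies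

  `‖D₃φ(x₀.1, β) − Δcf(β)‖ ≤ (4·modeConst·(driftConst + 1)·√864·(|β − (x₀.2 + s)| + A) + reanchorConst·|s|)·ε₁`.

Inside: the corrected profile `cf₁` of WW `exists_reanchored_profile` (slope and flux prescribed at the anchor; `‖Δcf₁ − Δcf‖ ≤ reanchorConst·|s|·ε₁` by
WR `norm_colFlux_drift_le` + WW `norm_slopeAt_sub_le`), the data bound WU `norm_chainFlux_profile_le_natAbs` at the anchor and scale `n/2` (transferred
by WW `sqrt_ratio_recentred`), the crude a-priori bound `‖D₃φ‖ ≤ √E` (`norm_latDiff_axis₃_le_sqrt`), and WV `bootstrap_increment_cubic`.  What is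
left for (PC) is the choice of finitely many anchors `s` and of `A(c, κ₀, ε)`, `L'(n)`, `B₀(n, ϱ)`, i.e. threshold bookkeeping.
-/

namespace Summit.AtomisticToContinuum.Crystallization.Theorems.ChartedZeroExcessLayeredLatticeLiouville

open Summit.AtomisticToContinuum.Crystallization.Theorems.ChartedPlanarOrderRigidityDoor (E3)
open Finset
open scoped InnerProductSpace RealInnerProductSpace BigOperators

noncomputable section AnchorStep

variable {c : ℝ} {a b : E3} {w : ℤ → E3}

/-! ### WX.1  A-priori bounds and cast bookkeeping -/

/-- a single bond of the ball is dominated by the ball energy. [formal bookkeeping] -/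
theorem norm_latDiff_sq_le_idxEnergy (φ : Cell 2 → ℤ → E3) {x₀ X : Cell 2 × ℤ} {n : ℝ} (E : Cell 2 × ℤ) (hX : dist X x₀ ≤ n)
    (hXE : dist (X + E) x₀ ≤ n) (hE : dist X (X + E) ≤ 1) : ‖latDiff E φ X.1 X.2‖ ^ 2 ≤ idxEnergy φ (idxBall x₀ n) := by
  rw [latDiff_apply, ← coe_idxBallF, idxEnergy_coe_finset]
  have hmem : ((X, X + E) : (Cell 2 × ℤ) × (Cell 2 × ℤ)) ∈ (idxBallF x₀ n ×ˢ idxBallF x₀ n).filter (fun x => dist x.1 x.2 ≤ 1) :=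
    mem_filter.mpr ⟨mk_mem_product (mem_idxBallF.mpr hX) (mem_idxBallF.mpr hXE), hE⟩
  have h := single_le_sum (f := fun x : (Cell 2 × ℤ) × (Cell 2 × ℤ) => ‖φ x.2.1 x.2.2 - φ x.1.1 x.1.2‖ ^ 2) (fun _ _ => sq_nonneg _) hmem
  exact h

/-- a site of the central column is at index distance `|k − x₀.2|` from the centre. [formal bookkeeping] -/
theorem dist_col_le (x₀ : Cell 2 × ℤ) (k : ℤ) : dist ((x₀.1, k) : Cell 2 × ℤ) x₀ ≤ |((k - x₀.2 : ℤ) : ℝ)| := by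
  have h := dist_site_le x₀ k (M := 0) (p := x₀.1) fun j => by rw [sub_self, abs_zero, Nat.cast_zero]
  rw [Nat.cast_zero, add_zero] at h
  exact h

/-- ★ the crude a-priori bound: a vertical bond of the central column inside the ball is at most `√E`. [this file, g58] -/
theorem norm_latDiff_axis₃_le_sqrt (φ : Cell 2 → ℤ → E3) (x₀ : Cell 2 × ℤ) {n : ℝ} {k : ℤ} (hk : |((k - x₀.2 : ℤ) : ℝ)| + 1 ≤ n) :
    ‖latDiff idxAxis₃ φ x₀.1 k‖ ≤ Real.sqrt (idxEnergy φ (idxBall x₀ n)) := by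
  have hX : dist ((x₀.1, k) : Cell 2 × ℤ) x₀ ≤ n := by linarith [dist_col_le x₀ k]
  have hXE : dist (((x₀.1, k) : Cell 2 × ℤ) + idxAxis₃) x₀ ≤ n := by
    have h1 := dist_add_idxAxis₃_le ((x₀.1, k) : Cell 2 × ℤ)
    rw [dist_comm] at h1
    linarith [dist_triangle (((x₀.1, k) : Cell 2 × ℤ) + idxAxis₃) ((x₀.1, k) : Cell 2 × ℤ) x₀, dist_col_le x₀ k]
  have h := norm_latDiff_sq_le_idxEnergy φ idxAxis₃ hX hXE (dist_add_idxAxis₃_le _)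
  calc ‖latDiff idxAxis₃ φ x₀.1 k‖ = Real.sqrt (‖latDiff idxAxis₃ φ x₀.1 k‖ ^ 2) := (Real.sqrt_sq (norm_nonneg _)).symm
    _ ≤ Real.sqrt (idxEnergy φ (idxBall x₀ n)) := Real.sqrt_le_sqrt h

/-- cast bookkeeping: a `natAbs` bound is a real absolute-value bound. [formal bookkeeping] -/
theorem abs_cast_le_of_natAbs_le {z : ℤ} {N : ℕ} (h : z.natAbs ≤ N) : |((z : ℤ) : ℝ)| ≤ (N : ℝ) := by
  rw [← Int.cast_abs, Int.abs_eq_natAbs]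
  exact_mod_cast h

/-- re-anchoring of absolute offsets: `|β − x₂| ≤ |β − (x₂ + s)| + |s|`. [formal bookkeeping] -/
theorem abs_sub_le_abs_sub_anchor (β x₂ s : ℤ) : |((β - x₂ : ℤ) : ℝ)| ≤ |((β - (x₂ + s) : ℤ) : ℝ)| + |(s : ℝ)| := by
  have h := abs_add_le (((β - (x₂ + s) : ℤ) : ℝ)) (s : ℝ)
  have e : ((β - (x₂ + s) : ℤ) : ℝ) + (s : ℝ) = ((β - x₂ : ℤ) : ℝ) := by push_cast; ring
  rwa [e] at h

/-- a flux box lies in the carrier as soon as the carrier contains every layer within `R` of `x₂` and the box centre is within `R − r − 1`.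
[formal bookkeeping] -/
theorem icc_subset_of_abs {T : Finset ℤ} {x₂ : ℤ} {R : ℝ} (hT₀ : ∀ β : ℤ, |((β - x₂ : ℤ) : ℝ)| ≤ R → β ∈ T) {m : ℤ} {r : ℕ}
    (hm : |((m - x₂ : ℤ) : ℝ)| + r + 1 ≤ R) : Icc (m - r) (m + 1 + r) ⊆ T := by
  intro β hβ
  rw [mem_Icc] at hβ
  have h1 : ((m : ℤ) : ℝ) - (r : ℝ) ≤ (β : ℝ) := by exact_mod_cast hβ.1
  have h2 : ((β : ℤ) : ℝ) ≤ (m : ℝ) + 1 + (r : ℝ) := by exact_mod_cast hβ.2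
  apply hT₀
  push_cast at hm ⊢
  have hm' := abs_le.mp (show |(m : ℝ) - (x₂ : ℝ)| ≤ R - r - 1 by linarith)
  rw [abs_le]
  constructor <;> linarith [hm'.1, hm'.2]

/-! ### WX.2  The re-anchoring constant -/

/-- the `ϱ`-FREE re-anchoring constant: `‖Δcf₁ − Δcf‖ ≤ reanchorConst·|s|·ε₁` for the corrected profile at offset `s` (mode constant times the
flux-drift and slope-drift coefficients of parts WR and WW). [this file, g58] -/
def reanchorConst (c κ₀ ε : ℝ) : ℝ :=
  modeConst c (κ₀ - ε / 2) * (216 * kernelConst c *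
    (Real.sqrt (864 * gradConst c κ₀ ε) + 2 * Real.sqrt (864 * (6912 * (54 * kernelConst c / κ₀) * lipConst c κ₀))) +
      441 * kernelConst c * (2 * Real.sqrt (864 * ipConst c κ₀ ε)))

/-- the re-anchoring constant is nonnegative. [formal bookkeeping] -/
theorem reanchorConst_nonneg (hc : 0 < c) {κ₀ ε : ℝ} (hε : ε < 2 * κ₀) : 0 ≤ reanchorConst c κ₀ ε := by
  have hδ : 0 < κ₀ - ε / 2 := by linarith
  have hM0 := modeConst_nonneg c hδ
  have hK0 := kernelConst_nonneg hc
  unfold reanchorConst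
  positivity

/-! ### WX.3  The anchored step -/

/-- ★★★ THE ANCHORED STEP: the cubic-threshold bootstrap of part WV, run at the anchor `(x₀.1, x₀.2 + s)` of the central column with the corrected
comparison profile of part WW, controls `‖D₃φ(x₀.1, β) − Δcf(β)‖` for `|β − (x₀.2 + s)| + A ≤ 3L'` by
`(4·modeConst·(driftConst + 1)·√864·(|β − (x₀.2 + s)| + A) + reanchorConst·|s|)·ε₁` — all analytic inputs discharged; only thresholds remain. [this file, g58] -/
theorem anchored_increment_le (hc : 0 < c) (hL : IsLayeredCrystal c a b w) {κ₀ ε ϱ : ℝ} (hκ₀ : 0 < κ₀) (hϱ : 0 ≤ ϱ) (hε : ε < 2 * κ₀)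
    (hK : CoerciveZ (layeredKernel a b w) κ₀)
    (hT : ∀ φ : Cell 2 → ℤ → E3, HasFiniteSupport φ → Summable (tailFam ϱ a b w φ) ∧ ∑' x, tailFam ϱ a b w φ x ≤ ε * nnFormZ φ)
    (hP : ∀ E₀ : Cell 2 × ℤ, E₀.2 = 0 → (idxNorm E₀ : ℝ) ≤ 1 → ∀ (y₀ : Cell 2 × ℤ) (r' n' : ℝ), r' < n' → ∀ χ : Cell 2 → ℤ → E3,
      IsTruncHarmonicZ ϱ a b w χ (idxBall y₀ (n' + 1)) →
        κ₀ * idxEnergy (latDiff E₀ χ) (idxBall y₀ r') ≤ 54 * kernelConst c * ((n' - r')⁻¹) ^ 2 * idxEnergy χ (idxBall y₀ (n' + ϱ / c + 1)))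
    (x₀ : Cell 2 × ℤ) {n : ℝ} (hn : 512 * (ϱ / c + 2) ≤ n / 2) {φ : Cell 2 → ℤ → E3} (hφ : IsTruncHarmonicZ ϱ a b w φ (idxBall x₀ n))
    {T : Finset ℤ} (hT₀ : ∀ β : ℤ, |((β - x₀.2 : ℤ) : ℝ)| ≤ n + 2 → β ∈ T)
    {cf : ℤ → E3} (hF : ∀ m : ℤ, columnFlux ϱ a b w ⌊ϱ / c⌋₊ (slopeAt φ x₀) cf m = colFlux ϱ a b w T φ x₀.1 x₀.2)
    {Bc : ℝ} (hBc : ∀ k : ℤ, ‖cf (k + 1) - cf k‖ ≤ Bc)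
    {ε₁ : ℝ} (hε₁ : 0 < ε₁) (hEε : Real.sqrt (idxEnergy φ (idxBall x₀ n) / (n ^ 2 * ((idxBall x₀ n).ncard : ℝ))) ≤ ε₁)
    (s : ℤ) (hs : |(s : ℝ)| + 3 * (⌊ϱ / c⌋₊ : ℝ) ≤ n / 2)
    {A L' : ℕ} (hA : 1 ≤ A) (hL' : 1 ≤ L') (hL6 : 6 * (L' : ℝ) + 3 * (⌊ϱ / c⌋₊ : ℝ) ≤ n / 4)
    (hA1 : 9408 * modeConst c (κ₀ - ε / 2) * kernelConst c ≤ ((A : ℕ) : ℝ) ^ 3)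
    (hA2 : 12 * modeConst c (κ₀ - ε / 2) * stabConst c (κ₀ - ε / 2) ≤ (((A : ℕ) : ℝ) + 2) ^ 2)
    {B₀ : ℝ} (hB : Real.sqrt (idxEnergy φ (idxBall x₀ n)) + Bc + reanchorConst c κ₀ ε * (n / 2) * ε₁ ≤ B₀)
    (hL1 : 1372 * kernelConst c * B₀ ≤ ((L' : ℕ) : ℝ) ^ 3 * (Real.sqrt 864 * ε₁))
    (hL2 : stabConst c (κ₀ - ε / 2) * B₀ ≤ ((L' : ℕ) : ℝ) ^ 3 * (Real.sqrt 864 * ε₁))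
    {β : ℤ} (hβ : (β - (x₀.2 + s)).natAbs + A ≤ 3 * L') :
    ‖latDiff idxAxis₃ φ x₀.1 β - (cf (β + 1) - cf β)‖ ≤
      (4 * modeConst c (κ₀ - ε / 2) * (driftConst c κ₀ ε + 1) * Real.sqrt 864 * (((((β - (x₀.2 + s)).natAbs : ℕ)) : ℝ) + A) +
        reanchorConst c κ₀ ε * |(s : ℝ)|) * ε₁ := by
  -- constants and scales
  have hδ : 0 < κ₀ - ε / 2 := by linarith
  have hM0 : 0 ≤ modeConst c (κ₀ - ε / 2) := modeConst_nonneg c hδ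
  have hK0 : 0 ≤ kernelConst c := kernelConst_nonneg hc
  have hK441 : 0 ≤ 441 * kernelConst c := by positivity
  have hD0 : 0 ≤ driftConst c κ₀ ε := driftConst_nonneg hc κ₀ ε
  have hR0 : 0 ≤ reanchorConst c κ₀ ε := reanchorConst_nonneg hc hε
  have hg0 : 0 ≤ gradConst c κ₀ ε := gradConst_nonneg hc hκ₀ ε
  have hip : 0 ≤ ipConst c κ₀ ε := ipConst_nonneg hc hκ₀ ε
  have hlip : 0 ≤ lipConst c κ₀ := by linarith [one_le_lipConst hc hκ₀]
  have hϱc : 0 ≤ ϱ / c := div_nonneg hϱ hc.le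
  have hr0 : (0 : ℝ) ≤ (⌊ϱ / c⌋₊ : ℝ) := Nat.cast_nonneg _
  have hn0 : 0 < n := by linarith
  have hn1 : 1 ≤ n := by linarith
  have hn' : 512 * (ϱ / c + 2) ≤ n := by linarith
  have hAr : (1 : ℝ) ≤ ((A : ℕ) : ℝ) := by exact_mod_cast hA
  have hL'r : (1 : ℝ) ≤ ((L' : ℕ) : ℝ) := by exact_mod_cast hL'
  have hs' : |(s : ℝ)| ≤ n / 2 := by linarith
  have hBc0 : 0 ≤ Bc := (norm_nonneg _).trans (hBc 0)
  have hEs : 0 ≤ Real.sqrt (idxEnergy φ (idxBall x₀ n) / (n ^ 2 * ((idxBall x₀ n).ncard : ℝ))) := Real.sqrt_nonneg _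
  -- the anchor
  have es : (((x₀.2 + s) - x₀.2 : ℤ) : ℝ) = (s : ℝ) := by push_cast; ring
  have hd₁ : dist ((x₀.1, x₀.2 + s) : Cell 2 × ℤ) x₀ ≤ |(s : ℝ)| := by
    have h := dist_col_le x₀ (x₀.2 + s)
    rwa [es] at h
  have hx₁ : ((x₀.1, x₀.2 + s) : Cell 2 × ℤ) ∈ idxBall x₀ (n / 2) :=
    show dist ((x₀.1, x₀.2 + s) : Cell 2 × ℤ) x₀ ≤ n / 2 from hd₁.trans hs'
  have hφ₁ : IsTruncHarmonicZ ϱ a b w φ (idxBall ((x₀.1, x₀.2 + s) : Cell 2 × ℤ) (n / 2)) :=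
    isTruncHarmonicZ_mono hφ (idxBall_half_subset hx₁)
  -- the corrected profile at the anchor
  obtain ⟨cf₁, hF₁, hΔ⟩ := exists_reanchored_profile hc hL hϱ hε hK hT (slopeAt φ x₀) (slopeAt φ ((x₀.1, x₀.2 + s) : Cell 2 × ℤ)) cf hF
    (colFlux ϱ a b w T φ x₀.1 (x₀.2 + s))
  -- the flux drift and the slope drift at the anchor
  have hFd : ‖colFlux ϱ a b w T φ x₀.1 (x₀.2 + s) - colFlux ϱ a b w T φ x₀.1 x₀.2‖ ≤ 216 * kernelConst c *
      (Real.sqrt (864 * gradConst c κ₀ ε) + 2 * Real.sqrt (864 * (6912 * (54 * kernelConst c / κ₀) * lipConst c κ₀))) * (|(s : ℝ)| * ε₁) := by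
    have hm : |(((x₀.2 + s) - x₀.2 : ℤ) : ℝ)| + 3 * (⌊ϱ / c⌋₊ : ℝ) ≤ n / 2 := by rw [es]; exact hs
    have hTm : ∀ β' : ℤ, |((β' - x₀.2 : ℤ) : ℝ)| ≤ |(((x₀.2 + s) - x₀.2 : ℤ) : ℝ)| + ⌊ϱ / c⌋₊ → β' ∈ T := by
      intro β' hβ'
      rw [es] at hβ'
      exact hT₀ β' (by linarith)
    have h := norm_colFlux_drift_le hc hL hκ₀ hϱ hε hK hT hP x₀ hn' hφ hm hTm
    rw [sqrt_scale_mul (by positivity : (0 : ℝ) ≤ 864 * gradConst c κ₀ ε),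
      sqrt_scale_mul (by positivity : (0 : ℝ) ≤ 864 * (6912 * (54 * kernelConst c / κ₀) * lipConst c κ₀)), es] at h
    calc ‖colFlux ϱ a b w T φ x₀.1 (x₀.2 + s) - colFlux ϱ a b w T φ x₀.1 x₀.2‖
        ≤ 216 * kernelConst c * (Real.sqrt (864 * gradConst c κ₀ ε) +
            2 * Real.sqrt (864 * (6912 * (54 * kernelConst c / κ₀) * lipConst c κ₀))) *
            (|(s : ℝ)| * Real.sqrt (idxEnergy φ (idxBall x₀ n) / (n ^ 2 * ((idxBall x₀ n).ncard : ℝ)))) := by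
          refine h.trans (le_of_eq ?_)
          ring
      _ ≤ _ := by gcongr
  have hgd : ∀ j : Fin 2, ‖slopeAt φ ((x₀.1, x₀.2 + s) : Cell 2 × ℤ) j - slopeAt φ x₀ j‖ ≤ Real.sqrt (864 * ipConst c κ₀ ε) * (|(s : ℝ)| * ε₁) := by
    intro j
    have h := norm_slopeAt_sub_le hc hL hκ₀ hϱ hε hK hT hP x₀ hn' hφ hx₁ j
    calc ‖slopeAt φ ((x₀.1, x₀.2 + s) : Cell 2 × ℤ) j - slopeAt φ x₀ j‖
        ≤ Real.sqrt (864 * ipConst c κ₀ ε) * (dist ((x₀.1, x₀.2 + s) : Cell 2 × ℤ) x₀ *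
            Real.sqrt (idxEnergy φ (idxBall x₀ n) / (n ^ 2 * ((idxBall x₀ n).ncard : ℝ)))) := by rw [← mul_assoc]; exact h
      _ ≤ Real.sqrt (864 * ipConst c κ₀ ε) * (|(s : ℝ)| * ε₁) := by gcongr
  -- the increment deviation of the corrected profile
  have hΔ' : ∀ k : ℤ, ‖(cf₁ (k + 1) - cf₁ k) - (cf (k + 1) - cf k)‖ ≤ reanchorConst c κ₀ ε * |(s : ℝ)| * ε₁ := by
    intro k
    refine (hΔ k).trans ?_
    have h0 := hgd 0
    have h1 := hgd 1
    calc modeConst c (κ₀ - ε / 2) * (‖colFlux ϱ a b w T φ x₀.1 (x₀.2 + s) - colFlux ϱ a b w T φ x₀.1 x₀.2‖ + 441 * kernelConst c *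
          (‖slopeAt φ ((x₀.1, x₀.2 + s) : Cell 2 × ℤ) 0 - slopeAt φ x₀ 0‖ + ‖slopeAt φ ((x₀.1, x₀.2 + s) : Cell 2 × ℤ) 1 - slopeAt φ x₀ 1‖))
        ≤ modeConst c (κ₀ - ε / 2) * (216 * kernelConst c * (Real.sqrt (864 * gradConst c κ₀ ε) +
            2 * Real.sqrt (864 * (6912 * (54 * kernelConst c / κ₀) * lipConst c κ₀))) * (|(s : ℝ)| * ε₁) + 441 * kernelConst c *
            (Real.sqrt (864 * ipConst c κ₀ ε) * (|(s : ℝ)| * ε₁) + Real.sqrt (864 * ipConst c κ₀ ε) * (|(s : ℝ)| * ε₁))) := by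
          gcongr
      _ = reanchorConst c κ₀ ε * |(s : ℝ)| * ε₁ := by
          unfold reanchorConst
          ring
  -- the carrier inclusions at the anchor
  have hTc : ∀ m : ℤ, (m - (x₀.2 + s)).natAbs ≤ 6 * L' → Icc (m - ⌊ϱ / c⌋₊) (m + 1 + ⌊ϱ / c⌋₊) ⊆ T := by
    intro m hm
    have habs : |((m - (x₀.2 + s) : ℤ) : ℝ)| ≤ 6 * (L' : ℝ) := by exact_mod_cast abs_cast_le_of_natAbs_le hm
    refine icc_subset_of_abs hT₀ ?_
    linarith [abs_sub_le_abs_sub_anchor m x₀.2 s]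
  -- the a-priori bound on the anchored comparison profile
  have hBd : ∀ k : ℤ, (k - (x₀.2 + s)).natAbs ≤ 9 * L' + ⌊ϱ / c⌋₊ → ‖(φ x₀.1 - cf₁) (k + 1) - (φ x₀.1 - cf₁) k‖ ≤ B₀ := by
    intro k hk
    have habs : |((k - (x₀.2 + s) : ℤ) : ℝ)| ≤ 9 * (L' : ℝ) + (⌊ϱ / c⌋₊ : ℝ) := by exact_mod_cast abs_cast_le_of_natAbs_le hk
    have hkx : |((k - x₀.2 : ℤ) : ℝ)| + 1 ≤ n := by linarith [abs_sub_le_abs_sub_anchor k x₀.2 s]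
    have hD := norm_latDiff_axis₃_le_sqrt φ x₀ hkx
    have e1 : cf₁ (k + 1) - cf₁ k = (cf (k + 1) - cf k) + ((cf₁ (k + 1) - cf₁ k) - (cf (k + 1) - cf k)) := by abel
    have hc₁ : ‖cf₁ (k + 1) - cf₁ k‖ ≤ Bc + reanchorConst c κ₀ ε * |(s : ℝ)| * ε₁ := by
      rw [e1]
      exact (norm_add_le _ _).trans (add_le_add (hBc k) (hΔ' k))
    have hsn : reanchorConst c κ₀ ε * |(s : ℝ)| * ε₁ ≤ reanchorConst c κ₀ ε * (n / 2) * ε₁ :=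
      mul_le_mul_of_nonneg_right (mul_le_mul_of_nonneg_left hs' hR0) hε₁.le
    rw [profile_increment_eq]
    calc ‖latDiff idxAxis₃ φ x₀.1 k - (cf₁ (k + 1) - cf₁ k)‖ ≤ ‖latDiff idxAxis₃ φ x₀.1 k‖ + ‖cf₁ (k + 1) - cf₁ k‖ := norm_sub_le _ _
      _ ≤ B₀ := by linarith
  -- the comparison data at the anchor (scale n/2), transferred to the scale of the big ball
  have hCF : ∀ m : ℤ, (m - (x₀.2 + s)).natAbs ≤ 6 * L' →
      ‖chainFlux ϱ a b w T (φ x₀.1 - cf₁) m‖ ≤ driftConst c κ₀ ε * (((((m - (x₀.2 + s)).natAbs : ℕ)) : ℝ) + A) * (Real.sqrt 864 * ε₁) := by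
    intro m hm
    have habs : |((m - (x₀.2 + s) : ℤ) : ℝ)| ≤ 6 * (L' : ℝ) := by exact_mod_cast abs_cast_le_of_natAbs_le hm
    have hm₁ : |((m - (x₀.2 + s) : ℤ) : ℝ)| + 3 * (⌊ϱ / c⌋₊ : ℝ) ≤ n / 2 / 2 := by linarith
    have hTb : ∀ β' : ℤ, |((β' - (x₀.2 + s) : ℤ) : ℝ)| ≤ |((m - (x₀.2 + s) : ℤ) : ℝ)| + ⌊ϱ / c⌋₊ → β' ∈ T := fun β' hβ' =>
      hT₀ β' (by linarith [abs_sub_le_abs_sub_anchor β' x₀.2 s])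
    have hWU : ‖chainFlux ϱ a b w T (φ x₀.1 - cf₁) m‖ ≤ driftConst c κ₀ ε * (((((m - (x₀.2 + s)).natAbs : ℕ)) : ℝ) + 1) *
        Real.sqrt (idxEnergy φ (idxBall ((x₀.1, x₀.2 + s) : Cell 2 × ℤ) (n / 2)) /
          ((n / 2) ^ 2 * ((idxBall ((x₀.1, x₀.2 + s) : Cell 2 × ℤ) (n / 2)).ncard : ℝ))) :=
      norm_chainFlux_profile_le_natAbs hc hL hκ₀ hϱ hε hK hT hP ((x₀.1, x₀.2 + s) : Cell 2 × ℤ) hn hφ₁ hF₁ hm₁ (hTc m hm) hTb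
    have hρ := (sqrt_ratio_recentred φ x₀ hn1 hx₁).trans (mul_le_mul_of_nonneg_left hEε (Real.sqrt_nonneg _))
    exact hWU.trans (mul_le_mul (mul_le_mul_of_nonneg_left (by linarith) hD0) hρ (Real.sqrt_nonneg _) (by positivity))
  -- the bootstrap at the anchor
  have hB₀ : 0 ≤ B₀ := by
    have : 0 ≤ reanchorConst c κ₀ ε * (n / 2) * ε₁ := by positivity
    linarith [Real.sqrt_nonneg (idxEnergy φ (idxBall x₀ n))]
  have hWV := bootstrap_increment_cubic hc hL hϱ hε hK hT (φ x₀.1 - cf₁) (x₀.2 + s) hA hL' hD0 (by positivity : (0 : ℝ) < Real.sqrt 864 * ε₁)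
    hB₀ hTc hCF hBd hA1 hA2 hL1 hL2 hβ
  rw [profile_increment_eq] at hWV
  -- conclusion
  have e3 : latDiff idxAxis₃ φ x₀.1 β - (cf (β + 1) - cf β) =
      (latDiff idxAxis₃ φ x₀.1 β - (cf₁ (β + 1) - cf₁ β)) + ((cf₁ (β + 1) - cf₁ β) - (cf (β + 1) - cf β)) := by abel
  rw [e3]
  refine (norm_add_le _ _).trans ?_
  calc ‖latDiff idxAxis₃ φ x₀.1 β - (cf₁ (β + 1) - cf₁ β)‖ + ‖cf₁ (β + 1) - cf₁ β - (cf (β + 1) - cf β)‖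
      ≤ 4 * modeConst c (κ₀ - ε / 2) * (driftConst c κ₀ ε + 1) * (((((β - (x₀.2 + s)).natAbs : ℕ)) : ℝ) + A) * (Real.sqrt 864 * ε₁) +
          reanchorConst c κ₀ ε * |(s : ℝ)| * ε₁ := add_le_add hWV (hΔ' β)
    _ = _ := by ring

/-! ### WX.4  The closed statement of this part -/

/-- The content of part WX as one closed proposition: the a-priori vertical bond bound and the anchored step. -/
def AnchorStepShape : Prop :=
  (∀ (φ : Cell 2 → ℤ → E3) (x₀ : Cell 2 × ℤ) (n : ℝ) (k : ℤ), |((k - x₀.2 : ℤ) : ℝ)| + 1 ≤ n →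
    ‖latDiff idxAxis₃ φ x₀.1 k‖ ≤ Real.sqrt (idxEnergy φ (idxBall x₀ n))) ∧
  ∀ c : ℝ, ∀ hc : 0 < c, ∀ (a b : E3) (w : ℤ → E3), ∀ hL : IsLayeredCrystal c a b w, ∀ κ₀ ε ϱ : ℝ, 0 < κ₀ → 0 ≤ ϱ → ε < 2 * κ₀ →
    CoerciveZ (layeredKernel a b w) κ₀ →
    (∀ φ : Cell 2 → ℤ → E3, HasFiniteSupport φ → Summable (tailFam ϱ a b w φ) ∧ ∑' x, tailFam ϱ a b w φ x ≤ ε * nnFormZ φ) →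
    (∀ E₀ : Cell 2 × ℤ, E₀.2 = 0 → (idxNorm E₀ : ℝ) ≤ 1 → ∀ (y₀ : Cell 2 × ℤ) (r' n' : ℝ), r' < n' → ∀ χ : Cell 2 → ℤ → E3,
      IsTruncHarmonicZ ϱ a b w χ (idxBall y₀ (n' + 1)) →
        κ₀ * idxEnergy (latDiff E₀ χ) (idxBall y₀ r') ≤ 54 * kernelConst c * ((n' - r')⁻¹) ^ 2 * idxEnergy χ (idxBall y₀ (n' + ϱ / c + 1))) →
    ∀ (x₀ : Cell 2 × ℤ) (n : ℝ), 512 * (ϱ / c + 2) ≤ n / 2 → ∀ φ : Cell 2 → ℤ → E3, IsTruncHarmonicZ ϱ a b w φ (idxBall x₀ n) →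
    ∀ T : Finset ℤ, (∀ β : ℤ, |((β - x₀.2 : ℤ) : ℝ)| ≤ n + 2 → β ∈ T) →
    ∀ cf : ℤ → E3, (∀ m : ℤ, columnFlux ϱ a b w ⌊ϱ / c⌋₊ (slopeAt φ x₀) cf m = colFlux ϱ a b w T φ x₀.1 x₀.2) →
    ∀ Bc : ℝ, (∀ k : ℤ, ‖cf (k + 1) - cf k‖ ≤ Bc) →
    ∀ ε₁ : ℝ, 0 < ε₁ → Real.sqrt (idxEnergy φ (idxBall x₀ n) / (n ^ 2 * ((idxBall x₀ n).ncard : ℝ))) ≤ ε₁ →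
    ∀ s : ℤ, |(s : ℝ)| + 3 * (⌊ϱ / c⌋₊ : ℝ) ≤ n / 2 →
    ∀ A L' : ℕ, 1 ≤ A → 1 ≤ L' → 6 * (L' : ℝ) + 3 * (⌊ϱ / c⌋₊ : ℝ) ≤ n / 4 →
    9408 * modeConst c (κ₀ - ε / 2) * kernelConst c ≤ ((A : ℕ) : ℝ) ^ 3 →
    12 * modeConst c (κ₀ - ε / 2) * stabConst c (κ₀ - ε / 2) ≤ (((A : ℕ) : ℝ) + 2) ^ 2 →
    ∀ B₀ : ℝ, Real.sqrt (idxEnergy φ (idxBall x₀ n)) + Bc + reanchorConst c κ₀ ε * (n / 2) * ε₁ ≤ B₀ →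
    1372 * kernelConst c * B₀ ≤ ((L' : ℕ) : ℝ) ^ 3 * (Real.sqrt 864 * ε₁) →
    stabConst c (κ₀ - ε / 2) * B₀ ≤ ((L' : ℕ) : ℝ) ^ 3 * (Real.sqrt 864 * ε₁) →
    ∀ β : ℤ, (β - (x₀.2 + s)).natAbs + A ≤ 3 * L' →
      ‖latDiff idxAxis₃ φ x₀.1 β - (cf (β + 1) - cf β)‖ ≤
        (4 * modeConst c (κ₀ - ε / 2) * (driftConst c κ₀ ε + 1) * Real.sqrt 864 * (((((β - (x₀.2 + s)).natAbs : ℕ)) : ℝ) + A) +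
          reanchorConst c κ₀ ε * |(s : ℝ)|) * ε₁

/-- WX holds. [this file, g58] -/
theorem anchorStepShape_holds : AnchorStepShape :=
  ⟨fun φ x₀ _n _k hk => norm_latDiff_axis₃_le_sqrt φ x₀ hk,
    fun _c hc _a _b _w hL _κ₀ _ε _ϱ hκ₀ hϱ hε hK hT hP x₀ _n hn _φ hφ _T hT₀ _cf hF _Bc hBc _ε₁ hε₁ hEε s hs _A _L' hA hL' hL6 hA1 hA2
      _B₀ hB hL1 hL2 _β hβ =>
      anchored_increment_le hc hL hκ₀ hϱ hε hK hT hP x₀ hn hφ hT₀ hF hBc hε₁ hEε s hs hA hL' hL6 hA1 hA2 hB hL1 hL2 hβ⟩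

end AnchorStep

end Summit.AtomisticToContinuum.Crystallization.Theorems.ChartedZeroExcessLayeredLatticeLiouville
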